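import Mathlib
import HarnessLib
import Summits.HubbardSuperconductivity.HubbardSuperconductivity.Theorems.WeakCouplingBCSKlAllOrdersSelection
import Summits.HubbardSuperconductivity.HubbardSuperconductivity.Theorems.WeakCouplingBCSKlThirdOrderSelectionInf

/-!
# Route `WeakCouplingBCS` — channel-margin lane of `WcbcsKohnLuttingerB1g` (stmt-HubbardSuperconductivity-0158):
# GENERIC BOX-WISE selection theorems for a window of rows (box-wise thresholds `U₀(μ)`)

`Theorems/WeakCouplingBCSKlThirdOrderSelectionBoxwise.lean` (margin-1 g8) states the box-wise thresholds — for every window row `w`, every `μ`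
of ITS box and every `0 < U ≤ w.row.U0` (instead of the window-uniform `u = min U0`) — for the one instance `klU0WindowRows` ×
`klCertB1gWin{A,B,C}`.  This file proves them for ARBITRARY `rows recs mub mua u` (hypotheses: the window checker `klU0WinCheck`, which already
contains `w.row.ok` for every row; the join `klThirdOrderWindowJoin`; the records' `checkB1gD` and `EnclosuresB1g`; the named window hypotheses),
so that the new windows of the lane (the `δ ≈ 0.20` cell record, the extension `klCertB1gWin{Z,Y,X}` towards `δ = 0.30`) get their box-wise
`U₀(μ)` statements as one-line instances:
* `klWindowRows_ok_of_check` (every row of a checked window passes `KLU0Row.ok` and has `u ≤ U0`), `klWindowRows_box_data`;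
* `klThirdOrder_selection_boxwiseRows`, `klResummed_selection_boxwiseRows`, `klAllOrders_selection_boxwiseRows` (rows' common `C4`, `U1` through
  the kernel-decidable side condition), `klThirdOrder_channelInf3_lt_boxwiseRows`.
No numbers, no new definitions; nothing here asserts superconductivity.  Cell file: U0-TABLE.md v4 (gate-hubbard-kl, margin-1 g9).

References: D. J. Scalapino, E. Loh, J. E. Hirsch, Phys. Rev. B 34 (1986) 8190, (3)–(4); S. Raghu, S. A. Kivelson, D. J. Scalapino,
Phys. Rev. B 81 (2010) 224505, App. A.
-/

noncomputable section

-- the tree's namespace `Summit.<Summit>.<Problem>.Theorems` repeats the summit name by design (D-0017)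
set_option linter.dupNamespace false

namespace Summit.HubbardSuperconductivity.HubbardSuperconductivity.Theorems

open MeasureTheory Literature.MathematicalPhysics.QuantumLattice CwKLChiralWindow KlThirdOrder
open Summit.HubbardSuperconductivity.HubbardSuperconductivity.Theses.WeakCouplingBCS

/-- Every row of a window passing `klU0WinCheck mub mua u` passes `KLU0Row.ok` and has `u ≤ U0` (the checker's `okAt u` clause). [folklore] -/
theorem klWindowRows_ok_of_check (rows : List KLU0WinRow) (mub mua u : ℚ) (hcheck : klU0WinCheck mub mua u rows = true)
    (w : KLU0WinRow) (hw : w ∈ rows) : w.row.ok = true ∧ u ≤ w.row.U0 := by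
  unfold klU0WinCheck at hcheck
  simp only [Bool.and_eq_true] at hcheck
  have h := List.all_eq_true.1 hcheck.2 w hw
  simp only [KLU0WinRow.okAt, Bool.and_eq_true, decide_eq_true_eq] at h
  exact ⟨h.1.1.2, h.2⟩

/-- **Box data of a row** (generic `klbw_box_data`): for a row `w` of a checked and joined window and a level `μ` of its box: a record `c ∈ recs`,
a box `bx ∈ c.boxes` containing `w`'s box and consistent with `w.row`, passing `basicOKB1gD`, `μ ∈ (-4, 0)`, the record's enclosures at `μ`, and
`w.row.ok`. [folklore] -/
theorem klWindowRows_box_data (rows : List KLU0WinRow) (recs : List KLCert) (mub mua u : ℚ)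
    (hcheck : klU0WinCheck mub mua u rows = true) (hjoin : klThirdOrderWindowJoin rows recs = true)
    (hrec : ∀ c ∈ recs, c.checkB1gD = true ∧ c.EnclosuresB1g)
    (w : KLU0WinRow) (hw : w ∈ rows) (μ : ℝ) (hlo : ((w.mulo : ℚ) : ℝ) ≤ μ) (hhi : μ ≤ ((w.muhi : ℚ) : ℝ)) :
    ∃ c ∈ recs, ∃ bx ∈ c.boxes,
      bx.mulo ≤ w.mulo ∧ w.muhi ≤ bx.muhi ∧ w.row.dominates bx c.trials = true ∧ bx.basicOKB1gD c.trials = true ∧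
      μ ∈ Set.Ioo (-4 : ℝ) 0 ∧ bx.bB1g.RitzEnclosure c.trials μ ∧
      (∀ χ : D4Irrep, χ ≠ D4Irrep.B1g → (bx.blk χ).Enclosure c.trials μ χ) ∧ w.row.ok = true := by
  obtain ⟨c, hc, bx, hbx, hcl, hch, hdom⟩ := klThirdOrderWindowJoin_spec _ _ hjoin w hw
  obtain ⟨hcheckc, hEc⟩ := hrec c hc
  obtain ⟨-, hboxes, -⟩ := klb1gd_coverLogic c hcheckc
  obtain ⟨hBx, -⟩ := hboxes bx hbx
  have hB' := hBx
  simp only [KLBox.basicOKB1gD, Bool.and_eq_true, decide_eq_true_eq] at hB'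
  obtain ⟨⟨⟨⟨⟨⟨⟨h4, -⟩, h0⟩, -⟩, -⟩, -⟩, -⟩, -⟩ := hB'
  have hlo' : ((bx.mulo : ℚ) : ℝ) ≤ μ := le_trans (by exact_mod_cast hcl) hlo
  have hhi' : μ ≤ ((bx.muhi : ℚ) : ℝ) := le_trans hhi (by exact_mod_cast hch)
  have hμ : μ ∈ Set.Ioo (-4 : ℝ) 0 :=
    ⟨lt_of_lt_of_le (by exact_mod_cast h4) hlo', lt_of_le_of_lt hhi' (by exact_mod_cast h0)⟩
  obtain ⟨hER, hEχ⟩ := hEc bx hbx μ ⟨hlo', hhi'⟩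
  have hok : w.row.ok = true := (klWindowRows_ok_of_check rows mub mua u hcheck w hw).1
  exact ⟨c, hc, bx, hbx, hcl, hch, hdom, hBx, hμ, hER, hEχ, hok⟩

/-- **Box-wise third-order selection** (generic): for every row `w` of a checked, joined window with the named window hypotheses, every `μ`
of its box and every `0 < U ≤ w.row.U0`, the normalised `B1g` trial lies strictly below every normalised `A1g/A2g/B2g/E` state in
`thirdOrderForm ε₀ μ U`. [cite: RaghuKivelsonScalapino2010, App. A] -/
theorem klThirdOrder_selection_boxwiseRows (rows : List KLU0WinRow) (recs : List KLCert) (mub mua u : ℚ)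
    (hcheck : klU0WinCheck mub mua u rows = true) (hjoin : klThirdOrderWindowJoin rows recs = true)
    (hrec : ∀ c ∈ recs, c.checkB1gD = true ∧ c.EnclosuresB1g)
    (h3 : KlThirdOrderWindowEnclosures rows recs) :
    ∀ w ∈ rows, ∀ μ : ℝ, ((w.mulo : ℚ) : ℝ) ≤ μ → μ ≤ ((w.muhi : ℚ) : ℝ) →
      ∃ ψ : Momentum → ℝ, IsChannelState (squareDispersion 1 0) μ D4Irrep.B1g ψ ∧
        ∀ U : ℝ, 0 < U → U ≤ ((w.row.U0 : ℚ) : ℝ) → ∀ χ : D4Irrep, χ ≠ D4Irrep.B1g →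
          ∀ φ : Momentum → ℝ, IsChannelState (squareDispersion 1 0) μ χ φ →
            thirdOrderForm (squareDispersion 1 0) μ U ψ < thirdOrderForm (squareDispersion 1 0) μ U φ := by
  intro w hw μ hlo hhi
  obtain ⟨c, hc, bx, hbx, hcl, hch, hdom, hBx, hμ, hER, hEχ, hok⟩ :=
    klWindowRows_box_data rows recs mub mua u hcheck hjoin hrec w hw μ hlo hhi
  have h3w := h3 w hw c hc bx hbx hcl hch hdom μ hlo hhi
  exact klThirdOrder_selectionD hμ bx c.trials hBx hER hEχ w.row hok hdom h3w

/-- **Box-wise selection with the chains resummed** (generic). [cite: ScalapinoLohHirsch1986, (3)-(4)] -/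
theorem klResummed_selection_boxwiseRows (rows : List KLU0WinRow) (recs : List KLCert) (mub mua u : ℚ)
    (hcheck : klU0WinCheck mub mua u rows = true) (hjoin : klThirdOrderWindowJoin rows recs = true)
    (hrec : ∀ c ∈ recs, c.checkB1gD = true ∧ c.EnclosuresB1g)
    (h3 : KlResummedWindowEnclosures rows recs) :
    ∀ w ∈ rows, ∀ μ : ℝ, ((w.mulo : ℚ) : ℝ) ≤ μ → μ ≤ ((w.muhi : ℚ) : ℝ) →
      ∃ ψ : Momentum → ℝ, IsChannelState (squareDispersion 1 0) μ D4Irrep.B1g ψ ∧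
        ∀ U : ℝ, 0 < U → U ≤ ((w.row.U0 : ℚ) : ℝ) → ∀ χ : D4Irrep, χ ≠ D4Irrep.B1g →
          ∀ φ : Momentum → ℝ, IsChannelState (squareDispersion 1 0) μ χ φ →
            resummedForm (squareDispersion 1 0) μ U ψ < resummedForm (squareDispersion 1 0) μ U φ := by
  intro w hw μ hlo hhi
  obtain ⟨c, hc, bx, hbx, hcl, hch, hdom, hBx, hμ, hER, hEχ, hok⟩ :=
    klWindowRows_box_data rows recs mub mua u hcheck hjoin hrec w hw μ hlo hhi
  have h3w := h3 w hw c hc bx hbx hcl hch hdom μ hlo hhi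
  exact klResummed_selectionD hμ bx c.trials hBx hER hEχ w.row hok hdom h3w

/-- **Box-wise selection to ALL orders** (generic), for every remainder kernel `R` with the rows' common form bound `C4₀` per `U⁴` on `(0, U1₀]`
(on the `B1g` trial of every record box at every `μ` of that box, and `≥ -C4₀` on normalised competitor states at every `μ`): for every row `w`,
every `μ` of its box and every `0 < U ≤ w.row.U0`, `B1g` strictly lowest in `resummedForm + U²⟨·, R U ·⟩`.  `C4₀` ASSUMED.
[cite: RaghuKivelsonScalapino2010, App. A] -/
theorem klAllOrders_selection_boxwiseRows (rows : List KLU0WinRow) (recs : List KLCert) (mub mua u C4₀ U1₀ : ℚ)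
    (hcheck : klU0WinCheck mub mua u rows = true) (hjoin : klThirdOrderWindowJoin rows recs = true)
    (hrec : ∀ c ∈ recs, c.checkB1gD = true ∧ c.EnclosuresB1g)
    (h3 : KlResummedWindowEnclosures rows recs)
    (hconsts : (rows.all fun w => decide (w.row.C4 = C4₀) && decide (w.row.U1 = U1₀)) = true)
    (R : ℝ → Momentum → Momentum → ℝ)
    (hRB : ∀ c ∈ recs, ∀ bx ∈ c.boxes, ∀ μ : ℝ,
      ((bx.mulo : ℚ) : ℝ) ≤ μ → μ ≤ ((bx.muhi : ℚ) : ℝ) → ∀ U : ℝ, 0 < U → U ≤ ((U1₀ : ℚ) : ℝ) →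
        kform (fermiCurveMeasure (squareDispersion 1 0) μ) (R U) (bx.bB1g.trialFun c.trials) ≤
          ((C4₀ : ℚ) : ℝ) * ∫ k, bx.bB1g.trialFun c.trials k ^ 2 ∂fermiCurveMeasure (squareDispersion 1 0) μ)
    (hRχ : ∀ μ : ℝ, ∀ U : ℝ, 0 < U → U ≤ ((U1₀ : ℚ) : ℝ) → ∀ χ : D4Irrep, χ ≠ D4Irrep.B1g →
      ∀ φ : Momentum → ℝ, IsChannelState (squareDispersion 1 0) μ χ φ →
        -((C4₀ : ℚ) : ℝ) ≤ kform (fermiCurveMeasure (squareDispersion 1 0) μ) (R U) φ) :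
    ∀ w ∈ rows, ∀ μ : ℝ, ((w.mulo : ℚ) : ℝ) ≤ μ → μ ≤ ((w.muhi : ℚ) : ℝ) →
      ∃ ψ : Momentum → ℝ, IsChannelState (squareDispersion 1 0) μ D4Irrep.B1g ψ ∧
        ∀ U : ℝ, 0 < U → U ≤ ((w.row.U0 : ℚ) : ℝ) → ∀ χ : D4Irrep, χ ≠ D4Irrep.B1g →
          ∀ φ : Momentum → ℝ, IsChannelState (squareDispersion 1 0) μ χ φ →
            resummedForm (squareDispersion 1 0) μ U ψ + U ^ 2 * kform (fermiCurveMeasure (squareDispersion 1 0) μ) (R U) ψ <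
              resummedForm (squareDispersion 1 0) μ U φ + U ^ 2 * kform (fermiCurveMeasure (squareDispersion 1 0) μ) (R U) φ := by
  intro w hw μ hlo hhi
  obtain ⟨c, hc, bx, hbx, hcl, hch, hdom, hBx, hμ, hER, hEχ, hok⟩ :=
    klWindowRows_box_data rows recs mub mua u hcheck hjoin hrec w hw μ hlo hhi
  have h3w := h3 w hw c hc bx hbx hcl hch hdom μ hlo hhi
  have hlo' : ((bx.mulo : ℚ) : ℝ) ≤ μ := le_trans (by exact_mod_cast hcl) hlo
  have hhi' : μ ≤ ((bx.muhi : ℚ) : ℝ) := le_trans hhi (by exact_mod_cast hch)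
  have hcw := List.all_eq_true.1 hconsts w hw
  simp only [Bool.and_eq_true, decide_eq_true_eq] at hcw
  obtain ⟨hC4q, hU1q⟩ := hcw
  have hC4 : (w.row.C4 : ℝ) = ((C4₀ : ℚ) : ℝ) := by rw [hC4q]
  have hU1 : (w.row.U1 : ℝ) = ((U1₀ : ℚ) : ℝ) := by rw [hU1q]
  have hRBw : ∀ U : ℝ, 0 < U → U ≤ w.row.U1 →
      kform (fermiCurveMeasure (squareDispersion 1 0) μ) (R U) (bx.bB1g.trialFun c.trials) ≤
        (w.row.C4 : ℝ) * ∫ k, bx.bB1g.trialFun c.trials k ^ 2 ∂fermiCurveMeasure (squareDispersion 1 0) μ := by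
    intro U hU hUU
    rw [hC4]
    exact hRB c hc bx hbx μ hlo' hhi' U hU (by rw [hU1] at hUU; exact hUU)
  have hRχw : ∀ U : ℝ, 0 < U → U ≤ w.row.U1 → ∀ χ : D4Irrep, χ ≠ D4Irrep.B1g →
      ∀ φ : Momentum → ℝ, IsChannelState (squareDispersion 1 0) μ χ φ →
        -(w.row.C4 : ℝ) ≤ kform (fermiCurveMeasure (squareDispersion 1 0) μ) (R U) φ := by
    intro U hU hUU χ hχ φ hφ
    rw [hC4]
    exact hRχ μ U hU (by rw [hU1] at hUU; exact hUU) χ hχ φ hφ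
  exact klAllOrders_selectionD hμ bx c.trials hBx hER hEχ w.row hok hdom h3w R hRBw hRχw

/-- **Box-wise channel bottoms** (generic): for every row `w`, every `μ` of its box, every `0 < U ≤ w.row.U0` and every `χ ≠ B1g`,
`channelInf3 ε₀ μ U B1g < channelInf3 ε₀ μ U χ`, given additionally the row's `A2g` datum read on the `B1g` states (a `B1g`-valid lower bound of the
`K₃`-form). [cite: RaghuKivelsonScalapino2010, App. A] -/
theorem klThirdOrder_channelInf3_lt_boxwiseRows (rows : List KLU0WinRow) (recs : List KLCert) (mub mua u : ℚ)
    (hcheck : klU0WinCheck mub mua u rows = true) (hjoin : klThirdOrderWindowJoin rows recs = true)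
    (hrec : ∀ c ∈ recs, c.checkB1gD = true ∧ c.EnclosuresB1g)
    (h3 : KlThirdOrderWindowEnclosures rows recs)
    (hB1g : ∀ w ∈ rows, ∀ μ : ℝ, ((w.mulo : ℚ) : ℝ) ≤ μ → μ ≤ ((w.muhi : ℚ) : ℝ) →
      (w.row.chanOf D4Irrep.A2g).ThirdOrderLowerBound μ D4Irrep.B1g) :
    ∀ w ∈ rows, ∀ μ : ℝ, ((w.mulo : ℚ) : ℝ) ≤ μ → μ ≤ ((w.muhi : ℚ) : ℝ) →
      ∀ U : ℝ, 0 < U → U ≤ ((w.row.U0 : ℚ) : ℝ) → ∀ χ : D4Irrep, χ ≠ D4Irrep.B1g →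
        channelInf3 (squareDispersion 1 0) μ U D4Irrep.B1g < channelInf3 (squareDispersion 1 0) μ U χ := by
  intro w hw μ hlo hhi
  obtain ⟨c, hc, bx, hbx, hcl, hch, hdom, hBx, hμ, hER, hEχ, hok⟩ :=
    klWindowRows_box_data rows recs mub mua u hcheck hjoin hrec w hw μ hlo hhi
  have h3w := h3 w hw c hc bx hbx hcl hch hdom μ hlo hhi
  obtain ⟨hritz, hlower⟩ := klto_lower_of_basicOKB1gD hμ bx c.trials hBx hEχ
  exact klThirdOrder_channelInf3_lt hμ bx c.trials hritz hER hlower w.row hok hdom h3w _ (hB1g w hw μ hlo hhi)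

end Summit.HubbardSuperconductivity.HubbardSuperconductivity.Theorems

end
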